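import Summits.AnomalousDissipation.AnomalousDissipation.Theorems.MarginalStabilityChainStrainedLayerLawClockNegMassAntitone
import HarnessLib

/-!
# Crux `MarginalStabilityChain.StrainedLayerLaw` (stmt-AnomalousDissipation-3007), line `FirstLemmasR2K4`
# (log-enstrophy clock + Nash roundness): the LONG-TIME LIMIT of the negative-vorticity mass `M₋(t) → m ≥ L`

Support file (`--supports stmt-AnomalousDissipation-3007`; registered sub-goal `negMass_tendsto` of line
`FirstLemmasR2K4`, lead c7, wave 3).

What it proves: along every classical solution `(u, v, p)` of the stretched two-dimensional Navier–Stokes layer class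
on `(0, ∞)` (viscosity `ν > 0`, period `L > 0`, normalisation `γ = ΔU = 1`) with uniform exponential shear tails on
every compact time window `[a, b] ⊂ (0, ∞)`, the mass of the negative vorticity over one period cell,
`M₋(t) = negMass L (u t) (v t) = ∫_{x ∈ (0,L]} ∫_y max(−ω, 0)`, CONVERGES as `t → ∞` to a limit `m ≥ L`.

Route (both ingredients LANDED): `t ↦ M₋(t)` is non-increasing on `(0, ∞)` (`negMass_antitone`, the one-way
cancellation law, `…ClockNegMassAntitone.lean`) and bounded below by the circulation floor `M₋(t) ≥ L` for every
`t > 0` (`stub_circulationFloor`, `…ClockStubCirculationFloor.lean`, tails constants from the window `[t, t + 1]`).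
The auxiliary function `g t := M₋(max t 1)` is antitone on all of `ℝ`, has range bounded below by `L`, and agrees
with `M₋` for `t ≥ 1`; Mathlib's monotone convergence `tendsto_atTop_ciInf` gives `g → ⨅ g =: m`, `le_ciInf` gives
`L ≤ m`, and `Filter.Tendsto.congr'` transfers the limit to `M₋`. No facts are cited. [folklore]
-/

-- `Summit.<Summit>.<Problem>` is the tree's mandated summit-side namespace (CONVENTIONS §2); for this
-- single-conjunct summit the two coincide, so the duplicate is deliberate.
set_option linter.dupNamespace false

noncomputable section

open scoped Topology ENNReal
open Filter Set Function MeasureTheory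

namespace Summit.AnomalousDissipation.AnomalousDissipation.Theorems.StrainedLayerLaw.LogEnstrophyClock

open Literature.Analysis.FluidPDE Literature.Analysis.FluidPDE.StretchedLayer
open Summit.AnomalousDissipation.AnomalousDissipation.Theses.MarginalStabilityChain
open Summit.AnomalousDissipation.AnomalousDissipation.Theorems.StrainedLayerLaw.StrainWorkSumRule

/-! ## The circulation floor along a solution -/

/-- **The circulation floor along a tailed solution.** For a classical solution of the stretched layer class on
`(0, ∞)` (`L > 0`) with shear tails on compact time windows, `L ≤ M₋(t)` for every `t > 0`: the landed slice
statement `stub_circulationFloor` fed with the slice regularity, periodicity and far field of the solution at the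
instant `t` and the tails constants of the window `[t, t + 1]`. [folklore] -/
theorem negMassLimit_floor {ν L : ℝ} {u v p : ℝ → ℝ → ℝ → ℝ} (hL : 0 < L)
    (hsol : IsStretchedLayerNSSolutionOn (Ioi 0) ν 1 1 L u v p)
    (htails : ∀ a b : ℝ, 0 < a → a < b → ExpTails (Icc a b) u v) {t : ℝ} (ht : 0 < t) :
    L ≤ negMass L (u t) (v t) := by
  obtain ⟨C, k, hk, hCk⟩ := htails t (t + 1) ht (lt_add_one t)
  have hST : SliceTails C k (u t) (v t) := (hCk t ⟨le_rfl, (lt_add_one t).le⟩).1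
  have ht' : t ∈ Ioi (0 : ℝ) := ht
  exact stub_circulationFloor L C k hL hk (u t) (v t) (hsol.contDiff_u ht') (hsol.contDiff_v ht')
    (hsol.periodic_u t ht') (hsol.periodic_v t ht') (by simpa using hsol.tendsto_u_atTop t ht')
    (by simpa using hsol.tendsto_u_atBot t ht') hST

/-! ## The stub -/

/-- **Registered sub-goal `negMass_tendsto` of line `FirstLemmasR2K4` (crux `StrainedLayerLaw`,
stmt-AnomalousDissipation-3007): the long-time limit of the negative-vorticity mass.** Along every classical
solution of the stretched layer class on `(0, ∞)` (`ν, L > 0`) with shear tails on compact time windows, the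
negative-vorticity mass `M₋(t) = negMass L (u t) (v t)` converges as `t → ∞` to a limit `m` with `L ≤ m`. The function
`g t := M₋(max t 1)` is antitone on `ℝ` (`negMass_antitone` on `(0, ∞)`), bounded below by `L` (`negMassLimit_floor`),
hence tends to `m := ⨅ g ≥ L` (`tendsto_atTop_ciInf`, `le_ciInf`); it agrees with `M₋` on `[1, ∞)`. [folklore] -/
theorem negMass_tendsto : ∀ (ν L : ℝ), 0 < ν → 0 < L → ∀ (u v p : ℝ → ℝ → ℝ → ℝ), IsStretchedLayerNSSolutionOn (Ioi 0) ν 1 1 L u v p → (∀ a b : ℝ, 0 < a → a < b → ExpTails (Icc a b) u v) → ∃ m : ℝ, L ≤ m ∧ Tendsto (fun t => negMass L (u t) (v t)) atTop (𝓝 m) := by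
  intro ν L hν hL u v p hsol htails
  -- the auxiliary antitone function on all of `ℝ`
  set g : ℝ → ℝ := fun t => negMass L (u (max t 1)) (v (max t 1)) with hgdef
  have hpos1 : ∀ t : ℝ, 0 < max t 1 := fun t => one_pos.trans_le (le_max_right t 1)
  have hg_anti : Antitone g := fun s t hst =>
    negMass_antitone ν L hν hL u v p hsol htails (max s 1) (max t 1) (hpos1 s) (max_le_max hst le_rfl)
  have hg_floor : ∀ t : ℝ, L ≤ g t := fun t => negMassLimit_floor hL hsol htails (hpos1 t)
  have hg_bdd : BddBelow (range g) := ⟨L, by rintro _ ⟨t, rfl⟩; exact hg_floor t⟩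
  have hg_tend : Tendsto g atTop (𝓝 (⨅ t, g t)) := tendsto_atTop_ciInf hg_anti hg_bdd
  refine ⟨⨅ t, g t, le_ciInf hg_floor, hg_tend.congr' ?_⟩
  filter_upwards [eventually_ge_atTop (1 : ℝ)] with t ht
  simp only [hgdef, max_eq_left ht]

end Summit.AnomalousDissipation.AnomalousDissipation.Theorems.StrainedLayerLaw.LogEnstrophyClock

end
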